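import Summits.Ventures.PercRepro.Night2OneFatCaseOneAssemblyB
import Summits.Ventures.PercRepro.Night2OneFatCaseOneCount

/-!
# PercRepro — the case-1 assembly, part C: the requests of the faces and the loss of a source (night-2, gen 29)

`faceReq F` = the request `Φ/(|G ∖ cl F| + 2)` of a face set `F` if it is a thin member, else `0` (§4⁗ G); it is admissible
for `m = |G ∖ cl F|` (`AdmissibleReq`): `7/24` at `m = 2`, `≤ 7/30` at `m ≥ 3`, and `7/24` only for a fat closure
(`faceReq_eq_fat_imp`).  For a source `y_a` whose erasure has the coloops `{w, y_b, y_c}`, the thin faces are the three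
faces at `w, y_b, y_c` (`thinFacesOf_eq_triple`), `L1 = req + req + req` (`L1_eq_three`), and the face losses sum to at most
`(L1 − 11/18)⁺` (`faceLossP_sum_le_L1_sub`, as in `faceLoss_sum_le_one_fat`).
-/

namespace PercRepro.Shadow

open Finset PerFlat ThmH

variable {α : Type*} [DecidableEq α] {M : Matroid α} [M.Finite]

section FaceReq

variable (M) (G : Finset α)

open scoped Classical in
/-- The request of a face set: `Φ/(|G ∖ cl F| + 2)` for a thin member, `0` otherwise. -/
noncomputable def faceReq (F : Finset α) : ℚ :=
  if F ∈ thinMembers M 5 G then phiQ 5 / (((G \ clF M F).card : ℚ) + 2) else 0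

end FaceReq

section AssemblyC

variable {G : Finset α}

open scoped Classical in
/-- The request of a thin member is its face request. -/
theorem req_eq_faceReq (hG : G ∈ flatsQ M (5 + 1)) (hd : (gr M \ G).card = 2) {F : Finset α}
    (hF : F ∈ thinMembers M 5 G) : req M 5 F = faceReq M G F := by
  unfold faceReq
  rw [if_pos hF, req_eq_of_thin hG hF, hd]
  push_cast
  ring

open scoped Classical in
/-- The face request is admissible for `m = |G ∖ cl F|` (`m ≥ 2`). -/
theorem admissible_faceReq {F : Finset α} (hm : 2 ≤ (G \ clF M F).card) :
    AdmissibleReq (G \ clF M F).card (faceReq M G F) := by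
  unfold faceReq
  refine ⟨?_, ?_, ?_⟩
  · split_ifs
    · unfold phiQ; positivity
    · exact le_refl _
  · intro h2
    split_ifs
    · right; rw [h2]; unfold phiQ; norm_num
    · left; rfl
  · intro h3
    split_ifs
    · unfold phiQ
      have h3' : (3 : ℚ) ≤ ((G \ clF M F).card : ℚ) := by exact_mod_cast h3
      rw [div_le_div_iff₀ (by linarith) (by norm_num)]
      push_cast
      linarith
    · norm_num

open scoped Classical in
/-- A face request equal to `7/24` comes from a fat closure. -/
theorem clF_mem_fatClosures_of_faceReq_eq {F : Finset α} (hm : 2 ≤ (G \ clF M F).card) (h : faceReq M G F = 7 / 24) :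
    F ∈ thinMembers M 5 G ∧ clF M F ∈ fatClosures M 5 G 2 := by
  unfold faceReq at h
  split_ifs at h with hF
  · refine ⟨hF, ?_⟩
    have hm2 : (G \ clF M F).card = 2 := by
      by_contra hne
      have h3 : (3 : ℚ) ≤ ((G \ clF M F).card : ℚ) := by exact_mod_cast (by omega : 3 ≤ (G \ clF M F).card)
      unfold phiQ at h
      rw [div_eq_iff (by linarith)] at h
      push_cast at h
      linarith
    unfold fatClosures
    rw [Finset.mem_image]
    exact ⟨F, Finset.mem_filter.2 ⟨hF, by omega⟩, rfl⟩
  · norm_num at h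

open scoped Classical in
/-- **The thin faces of a source's erasure are the faces at its three coloops.** -/
theorem thinFacesOf_eq_triple (hG : G ∈ flatsQ M (5 + 1)) (hd : (gr M \ G).card = 2) (hk : kColoops M G = 1)
    (hs : ∀ e ∈ gr M, ∀ f ∈ gr M, e ≠ f → rkN M {e, f} = 2) (hl : ∀ e ∈ gr M, M.Indep {e})
    {Q : Finset α} {w₀ : α} (hw₀ : w₀ ∈ Q) (h0 : faceLossP M 5 G (bigP M G) Q w₀ ≠ 0) {w y₂ y₃ : α}
    (hC : coloops M (Q \ coloops M G) = {w, y₂, y₃}) :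
    thinFacesOf M 5 G Q = {Q.erase w, Q.erase y₂, Q.erase y₃} := by
  obtain ⟨-, -, -, hImg, -, -⟩ := lossy_structure_of_faceLossP_ne_zero hG hd hk hs hl hw₀ h0
  rw [hImg, hC, Finset.image_insert, Finset.image_insert, Finset.image_singleton]

open scoped Classical in
/-- Every thin face of a lossy covering set is a thin member: the three faces are thin members. -/
theorem faces_thin_of_triple (hG : G ∈ flatsQ M (5 + 1)) (hd : (gr M \ G).card = 2) (hk : kColoops M G = 1)
    (hs : ∀ e ∈ gr M, ∀ f ∈ gr M, e ≠ f → rkN M {e, f} = 2) (hl : ∀ e ∈ gr M, M.Indep {e})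
    {Q : Finset α} {w₀ : α} (hw₀ : w₀ ∈ Q) (h0 : faceLossP M 5 G (bigP M G) Q w₀ ≠ 0) {w y₂ y₃ : α}
    (hC : coloops M (Q \ coloops M G) = {w, y₂, y₃}) :
    Q.erase w ∈ thinMembers M 5 G ∧ Q.erase y₂ ∈ thinMembers M 5 G ∧ Q.erase y₃ ∈ thinMembers M 5 G := by
  have hfaces := thinFacesOf_eq_triple hG hd hk hs hl hw₀ h0 hC
  have hmem : ∀ F ∈ thinFacesOf M 5 G Q, F ∈ thinMembers M 5 G := by
    intro F hF
    unfold thinFacesOf at hF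
    rw [Finset.mem_filter, mem_coverPreimages] at hF
    exact mem_thinMembers.2 ⟨hF.1.1, hF.2⟩
  refine ⟨hmem _ ?_, hmem _ ?_, hmem _ ?_⟩ <;> rw [hfaces] <;> simp

open scoped Classical in
/-- **`L1 Q = req (Q ∖ w) + req (Q ∖ y₂) + req (Q ∖ y₃)`** for a lossy covering set with coloops `{w, y₂, y₃}` (distinct). -/
theorem L1_eq_three (hG : G ∈ flatsQ M (5 + 1)) (hd : (gr M \ G).card = 2) (hk : kColoops M G = 1)
    (hs : ∀ e ∈ gr M, ∀ f ∈ gr M, e ≠ f → rkN M {e, f} = 2) (hl : ∀ e ∈ gr M, M.Indep {e})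
    {Q : Finset α} {w₀ : α} (hw₀ : w₀ ∈ Q) (h0 : faceLossP M 5 G (bigP M G) Q w₀ ≠ 0) {w y₂ y₃ : α}
    (hC : coloops M (Q \ coloops M G) = {w, y₂, y₃}) (h12 : w ≠ y₂) (h13 : w ≠ y₃) (h23 : y₂ ≠ y₃) :
    L1 M 5 G Q = req M 5 (Q.erase w) + req M 5 (Q.erase y₂) + req M 5 (Q.erase y₃) := by
  have hfaces := thinFacesOf_eq_triple hG hd hk hs hl hw₀ h0 hC
  have hwQ : w ∈ Q := by
    have : w ∈ coloops M (Q \ coloops M G) := by rw [hC]; simp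
    exact (Finset.mem_sdiff.1 (mem_coloops.1 this).1).1
  have hy₂Q : y₂ ∈ Q := by
    have : y₂ ∈ coloops M (Q \ coloops M G) := by rw [hC]; simp
    exact (Finset.mem_sdiff.1 (mem_coloops.1 this).1).1
  have hy₃Q : y₃ ∈ Q := by
    have : y₃ ∈ coloops M (Q \ coloops M G) := by rw [hC]; simp
    exact (Finset.mem_sdiff.1 (mem_coloops.1 this).1).1
  have hne₁ : Q.erase w ≠ Q.erase y₂ := fun h => by
    have : y₂ ∈ Q.erase w := Finset.mem_erase.2 ⟨h12.symm, hy₂Q⟩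
    rw [h] at this; exact (Finset.notMem_erase y₂ Q) this
  have hne₂ : Q.erase w ≠ Q.erase y₃ := fun h => by
    have : y₃ ∈ Q.erase w := Finset.mem_erase.2 ⟨h13.symm, hy₃Q⟩
    rw [h] at this; exact (Finset.notMem_erase y₃ Q) this
  have hne₃ : Q.erase y₂ ≠ Q.erase y₃ := fun h => by
    have : y₃ ∈ Q.erase y₂ := Finset.mem_erase.2 ⟨h23.symm, hy₃Q⟩
    rw [h] at this; exact (Finset.notMem_erase y₃ Q) this
  unfold L1
  have : (coverPreimages M (Uq M (5 + 2) 5) G Q).filter (fun F => F ∉ lay0 M 5 G) = thinFacesOf M 5 G Q := rfl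
  rw [this, hfaces, Finset.sum_insert, Finset.sum_insert, Finset.sum_singleton]
  · ring
  · rw [Finset.mem_singleton]; exact hne₃
  · rw [Finset.mem_insert, Finset.mem_singleton]; push Not; exact ⟨hne₁, hne₂⟩

open scoped Classical in
/-- **The face losses of a covering set sum to at most `(L1 − 11/18)⁺`** (cell `(2, 1)`; faces at `K` lose nothing). -/
theorem faceLossP_sum_le_L1_sub (hG : G ∈ flatsQ M (5 + 1)) (hd : (gr M \ G).card = 2) (hk : kColoops M G = 1)
    {Q : Finset α} (hQG : Q ⊆ G) :
    ∑ w ∈ Q, faceLossP M 5 G (bigP M G) Q w ≤ max (L1 M 5 G Q - 11 / 18) 0 := by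
  have hd' : (gr M \ G).card ≤ 5 := by omega
  have hzeroK : ∀ w ∈ Q, w ∈ coloops M G → faceLossP M 5 G (bigP M G) Q w = 0 := by
    intro w _ hwK
    unfold faceLossP
    rw [if_neg]
    rintro ⟨hthin', -, -⟩
    exact (Finset.notMem_erase w Q) (coloops_subset_of_mem_thinMembers hG hd' hthin' hwK)
  have hsum : ∑ w ∈ Q, faceLossP M 5 G (bigP M G) Q w = ∑ w ∈ Q \ coloops M G, faceLossP M 5 G (bigP M G) Q w := by
    symm
    apply Finset.sum_subset Finset.sdiff_subset
    intro w hw hwn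
    exact hzeroK w hw (by by_contra h; exact hwn (Finset.mem_sdiff.2 ⟨hw, h⟩))
  rw [hsum]
  have hle : ∑ w ∈ Q \ coloops M G, faceLossP M 5 G (bigP M G) Q w ≤ ∑ w ∈ Q \ coloops M G, faceLoss M 5 G Q w :=
    Finset.sum_le_sum (fun w _ => faceLossP_le_faceLoss (P := bigP M G) hG hd' Q w)
  have hL := sum_faceLoss_le_L1_mul hG hd' Q
  have hcap := capS_ge_eleven_eighteenths_two_one hd hk hQG
  have hcap0 : 0 ≤ capS M 5 G Q := by linarith
  by_cases hsat : L1 M 5 G Q ≤ capS M 5 G Q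
  · have hfS : fS M 5 G Q = 1 := by unfold fS; rw [if_pos hsat]
    rw [hfS] at hL
    have : ∑ w ∈ Q \ coloops M G, faceLoss M 5 G Q w ≤ 0 := by linarith
    exact le_trans (hle.trans this) (le_max_right _ _)
  · push Not at hsat
    have hfS : fS M 5 G Q = capS M 5 G Q / L1 M 5 G Q := by unfold fS; rw [if_neg (not_le.2 hsat)]
    have hL1pos : 0 < L1 M 5 G Q := by linarith
    have hexc : L1 M 5 G Q * (1 - fS M 5 G Q) = L1 M 5 G Q - capS M 5 G Q := by rw [hfS]; field_simp
    have : ∑ w ∈ Q \ coloops M G, faceLoss M 5 G Q w ≤ L1 M 5 G Q - 11 / 18 := by linarith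
    exact le_trans (hle.trans this) (le_max_left _ _)

end AssemblyC

end PercRepro.Shadow
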